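import Literature.Probability.Percolation.KSTPeriodicTopologyII

/-!
# Stub `kstTopology` of line `finite-size-envelope`, crux `CriticalPathRSW` (stmt-CriticalPhenomena-10267)

The planar-topology input of the weak periodic Köhler-Schindler–Tassion RSW theorem: the six
folklore facts about lattice walks of `ℤ²` named in
`Literature/Probability/Percolation/KSTPeriodicStatements.lean` — `ArchesMeet`,
`PartsToSegmentsMeet`, `PartsMeetMPath`, `TopSideToLeftMeetsTB`, `TopSideToRightMeetsTB`,
`AlternatingTBMeet`.  They are proved (for everyone) in the Literature files
`KSTPeriodicTopology.lean` and `KSTPeriodicTopologyII.lean`, each by extending the two walks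
outside their box by straight runs to a left–right and a top–bottom crossing of a slightly larger
box and invoking `exists_mem_support_of_crossing` (a left–right and a top–bottom crossing walk of a
rectangle meet).  This file only assembles the registered conjunction.
-/

namespace Summit.CriticalPhenomena.CardyFormulaZ2.Cruxes.CriticalPathRSW.FiniteSizeEnvelope

open Set MeasureTheory Filter Topology
open Literature.Probability.LatticeModels Literature.Probability.Percolation

/-- **Stub `kstTopology` (registered signature).** The six planar-topology facts about lattice
walks of `ℤ²` used by the weak periodic KST RSW theorem: interleaved arches meet; crossed
connections to the bottom segments meet; a bridge meets every `m`-path; a walk from the top side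
to the left (right) column crosses a top–bottom walk started to its left (right); top–bottom walks
with interleaved endpoints meet.  All proved in `KSTPeriodicTopology(II).lean`. -/
theorem stub_kstTopology :
  KSTPeriodic.ArchesMeet ∧ KSTPeriodic.PartsToSegmentsMeet ∧ KSTPeriodic.PartsMeetMPath ∧
    KSTPeriodic.TopSideToLeftMeetsTB ∧ KSTPeriodic.TopSideToRightMeetsTB ∧ KSTPeriodic.AlternatingTBMeet :=
  ⟨KSTPeriodic.archesMeet, KSTPeriodic.partsToSegmentsMeet, KSTPeriodic.partsMeetMPath,
    KSTPeriodic.topSideToLeftMeetsTB, KSTPeriodic.topSideToRightMeetsTB,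
    KSTPeriodic.alternatingTBMeet⟩

end Summit.CriticalPhenomena.CardyFormulaZ2.Cruxes.CriticalPathRSW.FiniteSizeEnvelope
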